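import Mathlib
import Summits.ValiantsHypothesis.ValiantsHypothesis.Theorems.MonotoneRestorationOrbitRestorationQPRowColumnEssential
import HarnessLib

/-!
# A derivative test for `ℂ[r, c]` and the quadratic lower bound on distinct affine factors (ORBIT currency)

Route MonotoneRestoration, crux `OrbitRestorationQP` (stmt-ValiantsHypothesis-18293), line `depth-three-rung`, registered stub
`stub_sigmaPiSigmaValue` (A_∞).  Namespace `Summit.ValiantsHypothesis.ValiantsHypothesis.Theorems.RowColumnLowerBound`.  Definition-free.

The essential-variable dichotomy (`Theorems/…RowColumnEssential.lean`) splits matrix-symmetric polynomials into `ℂ[r, c]` (row sums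
`r_i`, column sums `c_j`; restorable with an absolute constant, `…RowColumnStratum.lean`) and the rest, for which EVERY generating
space of affine forms contains all `(n−1)²` double-difference forms.  This file makes the split checkable and states the lower bound:

* `ddiffDeriv_eq_zero_of_mem_adjoin_rowcol` — **DERIVATIVE TEST**: every element of `ℂ[r, c]` is killed by each double-difference
  derivation `∂_{ab} − ∂_{a'b} − ∂_{ab'} + ∂_{a'b'}` (the derivation kills every `r_i` and `c_j`);
* `sq_le_card_distinct_factors` — **QUADRATIC LOWER BOUND**: if a matrix-symmetric `p` is not killed by some double-difference
  derivation, then every depth-three representation `p = Σ_{i<k} C(a i) · Π (L i)` (affine factors, any number of terms, any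
  fan-in) has at least `(n−1)²` DISTINCT factors;
* `sumSquares_not_killed`, `sq_le_card_distinct_factors_sumSquares` — the test at work on `Σ_{pq} x_pq²` (`n ≥ 2`).

Calibration: elementary; a weak (quadratic, counting distinct affine forms only) but unconditional `ΣΠΣ` lower bound for every
matrix-symmetric polynomial outside `ℂ[r, c]`, complementing the restoration of `ℂ[r, c]`.  Nothing here bears on VP ≠ VNP.
[folklore]

## References
* A. Dawar, G. Wilsenach, *Symmetric arithmetic circuits*, ToC 21 (2025), §3.3. [DawarWilsenach2025]
* N. Saxena, C. Seshadhri, *From Sylvester–Gallai configurations to rank bounds*, J. ACM 60 (2013). [SaxenaSeshadhri2013]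
-/

noncomputable section

open scoped Classical

-- `Summit.ValiantsHypothesis.ValiantsHypothesis.…` is the tree's single-conjunct layout (Sub = Summit).
set_option linter.dupNamespace false

namespace Summit.ValiantsHypothesis.ValiantsHypothesis.Theorems

namespace RowColumnLowerBound

open MvPolynomial Equiv

variable {n : ℕ}

/-! ### The double-difference derivations kill `ℂ[r, c]` -/

/-- `∂_{ab} x_Q = [Q = (a,b)]`. [folklore] -/
theorem pderiv_X_pair (P Q : Fin n × Fin n) :
    pderiv P (X Q : MvPolynomial (Fin n × Fin n) ℂ) = if Q = P then 1 else 0 := by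
  rw [pderiv_X, Pi.single_apply]

/-- `Σ_j [ (i,j) = (a,b) ] = [i = a]`. [folklore] -/
theorem sum_ite_row (i a b : Fin n) :
    (∑ j : Fin n, (if (i, j) = (a, b) then (1 : MvPolynomial (Fin n × Fin n) ℂ) else 0)) = if i = a then 1 else 0 := by
  by_cases h : i = a
  · rw [if_pos h, Finset.sum_eq_single b]
    · rw [if_pos (show ((i, b) : Fin n × Fin n) = (a, b) from Prod.ext h rfl)]
    · intro j _ hj; exact if_neg fun hP => hj (Prod.ext_iff.1 hP).2
    · intro hb; exact absurd (Finset.mem_univ _) hb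
  · rw [if_neg h]
    exact Finset.sum_eq_zero fun j _ => if_neg fun hP => h (Prod.ext_iff.1 hP).1

/-- `Σ_i [ (i,j) = (a,b) ] = [j = b]`. [folklore] -/
theorem sum_ite_col (j a b : Fin n) :
    (∑ i : Fin n, (if (i, j) = (a, b) then (1 : MvPolynomial (Fin n × Fin n) ℂ) else 0)) = if j = b then 1 else 0 := by
  by_cases h : j = b
  · rw [if_pos h, Finset.sum_eq_single a]
    · rw [if_pos (show ((a, j) : Fin n × Fin n) = (a, b) from Prod.ext rfl h)]
    · intro i _ hi; exact if_neg fun hP => hi (Prod.ext_iff.1 hP).1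
    · intro ha; exact absurd (Finset.mem_univ _) ha
  · rw [if_neg h]
    exact Finset.sum_eq_zero fun i _ => if_neg fun hP => h (Prod.ext_iff.1 hP).2

/-- **DERIVATIVE TEST.**  Every element of `ℂ[r, c]` is killed by the double-difference derivation
`∂_{ab} − ∂_{a'b} − ∂_{ab'} + ∂_{a'b'}`. [folklore] -/
theorem ddiffDeriv_eq_zero_of_mem_adjoin_rowcol {p : MvPolynomial (Fin n × Fin n) ℂ}
    (hp : p ∈ Algebra.adjoin ℂ (Set.range (fun i : Fin n => ∑ j : Fin n, (X (i, j) : MvPolynomial (Fin n × Fin n) ℂ)) ∪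
      Set.range (fun j : Fin n => ∑ i : Fin n, (X (i, j) : MvPolynomial (Fin n × Fin n) ℂ))))
    (a a' b b' : Fin n) :
    pderiv (a, b) p - pderiv (a', b) p - pderiv (a, b') p + pderiv (a', b') p = 0 := by
  induction hp using Algebra.adjoin_induction with
  | mem t ht =>
    rcases ht with ⟨i, rfl⟩ | ⟨j, rfl⟩
    · simp only [map_sum, pderiv_X_pair, sum_ite_row]
      ring
    · simp only [map_sum, pderiv_X_pair, sum_ite_col]
      ring
  | algebraMap r =>
    rw [MvPolynomial.algebraMap_eq]
    simp only [pderiv_C, sub_self, add_zero]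
  | add x y _ _ hx hy =>
    simp only [map_add]
    linear_combination hx + hy
  | mul x y _ _ hx hy =>
    simp only [Derivation.leibniz, smul_eq_mul]
    linear_combination x * hy + y * hx

/-! ### The quadratic lower bound on distinct affine factors -/

/-- **QUADRATIC LOWER BOUND.**  If a matrix-symmetric `p` is not killed by some double-difference derivation, every depth-three
representation `p = Σ_{i<k} C(a i) · Π (L i)` with affine factors has at least `(n−1)²` distinct factors. [folklore] -/
theorem sq_le_card_distinct_factors {p : MvPolynomial (Fin n × Fin n) ℂ}
    (hsym : ∀ σ τ : Perm (Fin n), rename (fun q : Fin n × Fin n => (σ q.1, τ q.2)) p = p)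
    {a₀ a₀' b₀ b₀' : Fin n}
    (hD : pderiv (a₀, b₀) p - pderiv (a₀', b₀) p - pderiv (a₀, b₀') p + pderiv (a₀', b₀') p ≠ 0)
    {k : ℕ} (a : Fin k → ℂ) (L : Fin k → Multiset (MvPolynomial (Fin n × Fin n) ℂ))
    (hL : ∀ i, ∀ ℓ ∈ L i, ℓ.totalDegree ≤ 1) (hp : p = ∑ i, C (a i) * (L i).prod) :
    (n - 1) ^ 2 ≤ (Finset.univ.biUnion fun i => (L i).toFinset).card := by
  have hnot : p ∉ Algebra.adjoin ℂ (Set.range (fun i : Fin n => ∑ j : Fin n, (X (i, j) : MvPolynomial (Fin n × Fin n) ℂ)) ∪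
      Set.range (fun j : Fin n => ∑ i : Fin n, (X (i, j) : MvPolynomial (Fin n × Fin n) ℂ))) :=
    fun h => hD (ddiffDeriv_eq_zero_of_mem_adjoin_rowcol h a₀ a₀' b₀ b₀')
  set S : Finset (MvPolynomial (Fin n × Fin n) ℂ) := insert (C 1) (Finset.univ.biUnion fun i => (L i).toFinset) with hS
  set Λ : Submodule ℂ (MvPolynomial (Fin n × Fin n) ℂ) := Submodule.span ℂ (S : Set (MvPolynomial (Fin n × Fin n) ℂ))
    with hΛ
  haveI : FiniteDimensional ℂ Λ := FiniteDimensional.span_finset ℂ S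
  have hadm : LinearSubalgebra.Admissible p Λ := by
    refine ⟨?_, Submodule.subset_span (by simp [hS]), ?_⟩
    · rw [hΛ, Submodule.span_le]
      intro x hx
      rw [hS, Finset.coe_insert, Set.mem_insert_iff] at hx
      rcases hx with rfl | hx
      · exact LinearSubalgebra.mem_deg1.2 (by rw [totalDegree_C]; exact Nat.zero_le _)
      · rw [Finset.mem_coe, Finset.mem_biUnion] at hx
        obtain ⟨i, -, hi⟩ := hx
        exact LinearSubalgebra.mem_deg1.2 (hL i x (Multiset.mem_toFinset.1 hi))
    · rw [hp]
      refine Subalgebra.sum_mem _ fun i _ => Subalgebra.mul_mem _ (Subalgebra.algebraMap_mem _ _) ?_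
      refine Subalgebra.multiset_prod_mem _ fun ℓ hℓ => Algebra.subset_adjoin ?_
      refine Submodule.subset_span ?_
      rw [hS, Finset.coe_insert]
      refine Set.mem_insert_of_mem _ ?_
      rw [Finset.mem_coe, Finset.mem_biUnion]
      exact ⟨i, Finset.mem_univ _, Multiset.mem_toFinset.2 hℓ⟩
  have h1 := RowColumnDichotomy.sq_succ_le_finrank_of_not_mem_adjoin_rowcol hsym hnot hadm
  have h2 : Module.finrank ℂ Λ ≤ S.card := finrank_span_finset_le_card S
  have h3 : S.card ≤ (Finset.univ.biUnion fun i => (L i).toFinset).card + 1 := Finset.card_insert_le _ _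
  omega

/-! ### Example: the sum of squares of the entries -/

/-- `Σ_{pq} x_pq²` is matrix-symmetric. [folklore] -/
theorem sumSquares_matrixSymmetric (σ τ : Perm (Fin n)) :
    rename (fun q : Fin n × Fin n => (σ q.1, τ q.2)) (∑ P : Fin n × Fin n, (X P : MvPolynomial (Fin n × Fin n) ℂ) ^ 2) =
      ∑ P : Fin n × Fin n, (X P : MvPolynomial (Fin n × Fin n) ℂ) ^ 2 := by
  simp only [map_sum, map_pow, rename_X]
  exact Equiv.sum_comp (Equiv.prodCongr σ τ) (fun P : Fin n × Fin n => (X P : MvPolynomial (Fin n × Fin n) ℂ) ^ 2)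

/-- The double-difference derivation of `Σ x_pq²` is `2 (x_ab − x_a'b − x_ab' + x_a'b')`. [folklore] -/
theorem ddiffDeriv_sumSquares (a a' b b' : Fin n) :
    pderiv (a, b) (∑ P : Fin n × Fin n, (X P : MvPolynomial (Fin n × Fin n) ℂ) ^ 2) -
        pderiv (a', b) (∑ P : Fin n × Fin n, (X P : MvPolynomial (Fin n × Fin n) ℂ) ^ 2) -
        pderiv (a, b') (∑ P : Fin n × Fin n, (X P : MvPolynomial (Fin n × Fin n) ℂ) ^ 2) +
        pderiv (a', b') (∑ P : Fin n × Fin n, (X P : MvPolynomial (Fin n × Fin n) ℂ) ^ 2) =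
      2 * (X (a, b) - X (a', b) - X (a, b') + X (a', b')) := by
  have key : ∀ Q : Fin n × Fin n, pderiv Q (∑ P : Fin n × Fin n, (X P : MvPolynomial (Fin n × Fin n) ℂ) ^ 2) = 2 * X Q := by
    intro Q
    rw [map_sum, Finset.sum_eq_single Q]
    · rw [sq, Derivation.leibniz, smul_eq_mul, pderiv_X_self]; ring
    · intro P _ hP
      rw [sq, Derivation.leibniz, smul_eq_mul, pderiv_X_of_ne hP]; ring
    · intro h; exact absurd (Finset.mem_univ _) h
  simp only [key]
  ring

/-- For `n ≥ 2` the sum of squares is not killed by the derivation `∂_{00} − ∂_{10} − ∂_{01} + ∂_{11}`. [folklore] -/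
theorem sumSquares_not_killed (hn : 2 ≤ n) :
    pderiv ((⟨0, by omega⟩ : Fin n), (⟨0, by omega⟩ : Fin n)) (∑ P : Fin n × Fin n, (X P : MvPolynomial (Fin n × Fin n) ℂ) ^ 2) -
        pderiv ((⟨1, by omega⟩ : Fin n), (⟨0, by omega⟩ : Fin n))
          (∑ P : Fin n × Fin n, (X P : MvPolynomial (Fin n × Fin n) ℂ) ^ 2) -
        pderiv ((⟨0, by omega⟩ : Fin n), (⟨1, by omega⟩ : Fin n))
          (∑ P : Fin n × Fin n, (X P : MvPolynomial (Fin n × Fin n) ℂ) ^ 2) +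
        pderiv ((⟨1, by omega⟩ : Fin n), (⟨1, by omega⟩ : Fin n))
          (∑ P : Fin n × Fin n, (X P : MvPolynomial (Fin n × Fin n) ℂ) ^ 2) ≠ 0 := by
  rw [ddiffDeriv_sumSquares]
  intro h
  have h2 : (X ((⟨0, by omega⟩ : Fin n), (⟨0, by omega⟩ : Fin n)) - X ((⟨1, by omega⟩ : Fin n), (⟨0, by omega⟩ : Fin n)) -
      X ((⟨0, by omega⟩ : Fin n), (⟨1, by omega⟩ : Fin n)) + X ((⟨1, by omega⟩ : Fin n), (⟨1, by omega⟩ : Fin n)) :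
      MvPolynomial (Fin n × Fin n) ℂ) = 0 := by
    rcases mul_eq_zero.1 h with h | h
    · exact absurd h two_ne_zero
    · exact h
  have h3 := congrArg (coeff (Finsupp.single ((⟨0, by omega⟩ : Fin n), (⟨0, by omega⟩ : Fin n)) 1)) h2
  rw [coeff_add, coeff_sub, coeff_sub, RowColumnDichotomy.coeff_single_X, RowColumnDichotomy.coeff_single_X,
    RowColumnDichotomy.coeff_single_X, RowColumnDichotomy.coeff_single_X, coeff_zero, if_pos rfl,
    if_neg (fun h => absurd (congrArg Fin.val (Prod.ext_iff.1 h).1) (by norm_num)),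
    if_neg (fun h => absurd (congrArg Fin.val (Prod.ext_iff.1 h).2) (by norm_num)),
    if_neg (fun h => absurd (congrArg Fin.val (Prod.ext_iff.1 h).1) (by norm_num))] at h3
  norm_num at h3

/-- **The sum of squares needs `(n−1)²` distinct affine factors** in every depth-three representation (`n ≥ 2`). [folklore] -/
theorem sq_le_card_distinct_factors_sumSquares (hn : 2 ≤ n) {k : ℕ} (a : Fin k → ℂ)
    (L : Fin k → Multiset (MvPolynomial (Fin n × Fin n) ℂ)) (hL : ∀ i, ∀ ℓ ∈ L i, ℓ.totalDegree ≤ 1)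
    (hp : (∑ P : Fin n × Fin n, (X P : MvPolynomial (Fin n × Fin n) ℂ) ^ 2) = ∑ i, C (a i) * (L i).prod) :
    (n - 1) ^ 2 ≤ (Finset.univ.biUnion fun i => (L i).toFinset).card :=
  sq_le_card_distinct_factors sumSquares_matrixSymmetric (sumSquares_not_killed hn) a L hL hp

end RowColumnLowerBound

end Summit.ValiantsHypothesis.ValiantsHypothesis.Theorems

end
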